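import Summits.ResolutionOfSingularities.ResolutionOfSingularities.Theses.CleanCovers
import Literature.AlgebraicGeometry.Resolution.NonReducedNoResolution
import Literature.AlgebraicGeometry.Resolution.PrincipalizationToResolution
import Literature.AlgebraicGeometry.Motives.ProjectiveSpaceFieldPoints
import Literature.AlgebraicGeometry.Motives.VarietiesProperProofs

/-!
# `CoverResolution` — negative lemmas I: the load-bearing hypotheses

Support (negative) lemmas for crux `stmt-ResolutionOfSingularities-15104`
(`Summit.ResolutionOfSingularities.ResolutionOfSingularities.Theses.CleanCovers.CoverResolution`:
for every prime `p`, perfect field `k` of characteristic `p`, `n`, every INTEGRAL scheme `X` and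
every FINITE SURJECTIVE `f : X → ℙⁿ_k` that is ÉTALE over the chart `D₊(xₙ) ≅ 𝔸ⁿ_k`, `X` has a
resolution), filed by the standing disprover (cdisprove cycle 1; work file
`Cruxes/CoverResolution/Disproof.lean`, which carries the full analysis, including the PAPER
witness showing that `IsFinite f` is load-bearing for `n ≥ 2` and not for `n ≤ 1`). This file
declares NO definition: every variant statement is written out inline, and NO declaration
concludes the route decl `CoverResolution` positively.

* `coverResolution_false_without_isIntegral` — with `IsIntegral X` dropped the statement is FALSE:
  `p = 2`, `k = 𝔽₂`, `n = 1`, `X = ℙ¹_k ⨿ Spec k[ε]`, `f = 𝟙 ⨿ [1 : 0]` is finite, surjective and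
  an open immersion over `D₊(x₁)` (the fat point sits over `[1 : 0] ∈ V₊(x₁)`), but `X` has no
  resolution since its open summand `Spec k[ε]` has none
  (`Literature…not_hasResolution_spec_dualNumber`).
* `coverResolution_stripped_of_resolutionOfSingularities` — which PART of integrality is needed:
  modulo the summit the crux holds with `IsIntegral` weakened to `IsReduced` and with
  `PerfectField`, étaleness over the chart and surjectivity DELETED (a reduced scheme finite over
  `ℙⁿ_k` is separated of finite type over `k`). So reducedness is the load-bearing content of
  `IsIntegral`; irreducibility, perfectness, étaleness and surjectivity are the Kedlaya normal
  form — what a proof is invited to use, not what it is forced to use.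
* `coverResolution_without_prime_of_hironaka` — `p.Prime` is decoration modulo the named fact
  `Hironaka1964`: `CharP k p` for a field forces `p` prime (the crux) or `p = 0` (Hironaka).

## Sources
* The Stacks Project, Tags 01RN (birational morphisms), 02IS (regular schemes).
* H. Matsumura, *Commutative Ring Theory*, Thm. 14.3 (regular local rings are domains) — through
  `not_hasResolution_spec_dualNumber`.
* K. Kedlaya, *More étale covers of affine spaces in positive characteristic*, J. Algebraic Geom. 14
  (2005), Thm. 1 (the normal form; why the deleted hypotheses are an offer, not a constraint).
-/

noncomputable section

set_option linter.dupNamespace false -- mandated namespace of this single-conjunct summit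

open CategoryTheory CategoryTheory.Limits AlgebraicGeometry
open Literature.AlgebraicGeometry.Resolution Literature.AlgebraicGeometry.Motives
open Summit.ResolutionOfSingularities.ResolutionOfSingularities.Theses.CleanCovers

namespace Summit.ResolutionOfSingularities.ResolutionOfSingularities.Theorems.CoverResolution.Negative

/-- A `k`-rational point of `ℙⁿ_k` (a `k`-morphism `Spec k → ℙⁿ_k`) is a closed immersion: it is a
section of the structure morphism `ℙⁿ_k → Spec k` (Mathlib `isClosedImmersion_of_comp_eq_id`).
[folklore] -/
theorem isClosedImmersion_left_of_algPoints (k : Type) [Field k] (n : ℕ)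
    (P : AlgPoints (projectiveSpace n k) k) : IsClosedImmersion P.left := by
  haveI : Subsingleton ↥(Spec (CommRingCat.of k)) :=
    inferInstanceAs (Subsingleton (PrimeSpectrum k))
  have h := Over.w P
  have h2 : (specOver k k).hom = 𝟙 (Spec (.of k)) := by
    change Spec.map (CommRingCat.ofHom (algebraMap k k)) = 𝟙 _
    rw [Algebra.algebraMap_self, CommRingCat.ofHom_id]; exact Spec.map_id _
  exact isClosedImmersion_of_comp_eq_id (Y := Spec (.of k)) (projectiveSpace n k).hom P.left
    (h.trans h2)

/-- **`IsIntegral X` is load-bearing in `CoverResolution`: the crux with it deleted is FALSE.**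
Witness `p = 2`, `k = 𝔽₂`, `n = 1`, `X = ℙ¹_k ⨿ Spec k[ε]`,
`f = 𝟙 ⨿ (Spec k[ε] → Spec k = [1 : 0] ↪ ℙ¹_k)`: `f` is finite (identity ⨿ (finite ≫ closed
immersion)), surjective (identity summand) and an open immersion — a fortiori étale — over
`D₊(x₁)`, because the fat point lies over `[1 : 0] ∈ V₊(x₁)` so that `f⁻¹(D₊(x₁)) ↪ X` factors through
the summand `ℙ¹`, on which `f` is the identity; yet `X` has no resolution: a resolution restricts
along the open immersion `Spec k[ε] ↪ X` (`Scheme.HasResolution.of_isOpenImmersion`) and `Spec k[ε]`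
has none (`not_hasResolution_spec_dualNumber`). Hence every proof of the crux uses reducedness of
`X` at the generic points of `f⁻¹(V₊(xₙ))`; by `coverResolution_stripped_of_resolutionOfSingularities`
it need not use irreducibility. [folklore] -/
theorem coverResolution_false_without_isIntegral :
    ¬ (∀ p : ℕ, p.Prime → ∀ (k : Type) [Field k] [CharP k p] [PerfectField k] (n : ℕ)
        (X : AlgebraicGeometry.Scheme.{0})
        (f : X ⟶ (Literature.AlgebraicGeometry.Motives.projectiveSpace n k).left),
        AlgebraicGeometry.IsFinite f → Function.Surjective f.base →
        (letI := MvPolynomial.gradedAlgebra (σ := Fin (n + 1)) (R := k);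
          AlgebraicGeometry.Etale (f ∣_ (AlgebraicGeometry.Proj.basicOpen
            (MvPolynomial.homogeneousSubmodule (Fin (n + 1)) k) (MvPolynomial.X (Fin.last n))))) →
        Literature.AlgebraicGeometry.Resolution.Scheme.HasResolution X) := by
  intro h
  letI := MvPolynomial.gradedAlgebra (σ := Fin (1 + 1)) (R := ZMod 2)
  let P : Scheme.{0} := (projectiveSpace 1 (ZMod 2)).left
  let T : Scheme.{0} := Spec (.of (DualNumber (ZMod 2)))
  let z : Fin (1 + 1) → ZMod 2 := Pi.single 0 1
  have hz : z ≠ 0 := by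
    intro h0; have := congrFun h0 0; simp [z] at this
  let Pv := ProjectiveSpace.pointOfVec (n := 1) (ZMod 2) z hz
  let φ : T ⟶ (specOver (ZMod 2) (ZMod 2)).left :=
    Spec.map (CommRingCat.ofHom (algebraMap (ZMod 2) (DualNumber (ZMod 2))))
  let g : T ⟶ P := φ ≫ Pv.left
  let W : P.Opens :=
    Proj.basicOpen (MvPolynomial.homogeneousSubmodule (Fin (1 + 1)) (ZMod 2)) (MvPolynomial.X (Fin.last 1))
  have hPvW : Pv.pt ∉ W := by
    show Pv.pt ∉ Proj.basicOpen _ (MvPolynomial.X (Fin.last 1))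
    rw [ProjectiveSpace.pt_pointOfVec_mem_basicOpen_X_iff z hz (Fin.last 1)]
    simp [z]
  have hg : ∀ t : T, g.base t ∉ W := by
    intro t
    have ht : g.base t = Pv.pt := by
      show Pv.left.base (φ.base t) = Pv.left.base (IsLocalRing.closedPoint (ZMod 2))
      haveI : Subsingleton ↥(specOver (ZMod 2) (ZMod 2)).left :=
        inferInstanceAs (Subsingleton (PrimeSpectrum (ZMod 2)))
      rw [Subsingleton.elim (φ.base t) (IsLocalRing.closedPoint (ZMod 2))]
    rw [ht]; exact hPvW
  let X : Scheme.{0} := P ⨿ T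
  let f : X ⟶ P := coprod.desc (𝟙 P) g
  -- `f` is finite
  haveI : IsFinite φ := by
    haveI : Module.Finite (ZMod 2) (DualNumber (ZMod 2)) :=
      inferInstanceAs (Module.Finite (ZMod 2) (ZMod 2 × ZMod 2))
    show IsFinite (Spec.map _)
    rw [IsFinite.SpecMap_iff]
    exact RingHom.finite_algebraMap.mpr inferInstance
  haveI : IsClosedImmersion Pv.left := isClosedImmersion_left_of_algPoints (ZMod 2) 1 Pv
  haveI : IsFinite g := MorphismProperty.comp_mem @IsFinite φ Pv.left ‹IsFinite φ› inferInstance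
  haveI hfin : IsFinite f := inferInstance
  -- `f` is surjective (the identity summand)
  have hsurj : Function.Surjective f.base := by
    intro y
    refine ⟨(coprod.inl : P ⟶ X).base y, ?_⟩
    show ((coprod.inl : P ⟶ X) ≫ f).base y = y
    simp only [f, coprod.inl_desc]
    rfl
  -- `f` is an open immersion (hence étale) over the chart `W = D₊(x₁)`: `f⁻¹ W` misses the fat point,
  -- so `f⁻¹ W ↪ X` factors through the summand `ℙ¹`, on which `f` is the identity.
  have hrange : Set.range (f ⁻¹ᵁ W).ι.base ⊆ Set.range (coprod.inl : P ⟶ X).base := by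
    rintro _ ⟨x, rfl⟩
    obtain ⟨y | t, hy⟩ := (coprodMk P T).surjective x.1
    · refine ⟨y, ?_⟩
      rw [← coprodMk_inl]
      exact hy
    · exfalso
      have hx : f.base x.1 ∈ W := x.2
      rw [← hy, coprodMk_inr] at hx
      apply hg t
      have e : f.base ((coprod.inr : T ⟶ X).base t) = g.base t := by
        show ((coprod.inr : T ⟶ X) ≫ f).base t = g.base t
        simp only [f, coprod.inr_desc]
      rw [← e]
      exact hx
  let l := IsOpenImmersion.lift (coprod.inl : P ⟶ X) (f ⁻¹ᵁ W).ι hrange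
  have hl : l ≫ coprod.inl = (f ⁻¹ᵁ W).ι := IsOpenImmersion.lift_fac _ _ hrange
  haveI : IsOpenImmersion l := by
    haveI : IsOpenImmersion (l ≫ (coprod.inl : P ⟶ X)) := by rw [hl]; infer_instance
    exact IsOpenImmersion.of_comp l (coprod.inl : P ⟶ X)
  have hfW : (f ∣_ W) ≫ W.ι = l := by
    rw [morphismRestrict_ι, ← hl, Category.assoc]
    simp only [f, coprod.inl_desc, Category.comp_id]
  haveI : IsOpenImmersion (f ∣_ W) := by
    haveI : IsOpenImmersion ((f ∣_ W) ≫ W.ι) := by rw [hfW]; infer_instance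
    exact IsOpenImmersion.of_comp (f ∣_ W) W.ι
  have het : Etale (f ∣_ W) := inferInstance
  -- conclude: `X` would have a resolution, hence so would its open summand `Spec k[ε]`
  have hres : Scheme.HasResolution X := h 2 Nat.prime_two (ZMod 2) 1 X f hfin hsurj het
  exact not_hasResolution_spec_dualNumber (ZMod 2)
    (Scheme.HasResolution.of_isOpenImmersion (coprod.inr : T ⟶ X) hres)

/-- **Reducedness is the load-bearing content of integrality; perfectness, étaleness over the chart
and surjectivity are not load-bearing modulo the summit.** The summit `ResolutionOfSingularities`
implies the crux with `IsIntegral X` weakened to `IsReduced X` and with `PerfectField k`,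
`Etale (f ∣_ D₊(xₙ))`, `Function.Surjective f.base` deleted: a reduced scheme finite over `ℙⁿ_k` is
separated, of finite type and quasi-compact over `k` (finite ⇒ affine; `ℙⁿ_k → Spec k` proper), so
`ResolutionInChar p` applies. (Conversely the crux implies the summit over perfect fields by
Kedlaya 2004, Thm. 1 — tree `Kedlaya2004_finite_etale_off_hyperplane_holds` — so the deleted
hypotheses are the normal form a proof may exploit, never a constraint it must respect.)
[folklore] -/
theorem coverResolution_stripped_of_resolutionOfSingularities
    (hS : _root_.ResolutionOfSingularities) :
    ∀ p : ℕ, p.Prime → ∀ (k : Type) [Field k] [CharP k p] (n : ℕ) (X : Scheme.{0})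
      (f : X ⟶ (projectiveSpace n k).left), IsReduced X → IsFinite f →
      Scheme.HasResolution X := by
  intro p hp k _ _ n X f hred hfin
  haveI := hfin
  haveI : IsProper (projectiveSpace n k).hom := isProper_projectiveSpace n k
  let g : X ⟶ Spec (.of k) := f ≫ (projectiveSpace n k).hom
  haveI : IsSeparated g := inferInstanceAs (IsSeparated (f ≫ (projectiveSpace n k).hom))
  haveI : LocallyOfFiniteType g :=
    inferInstanceAs (LocallyOfFiniteType (f ≫ (projectiveSpace n k).hom))
  haveI : QuasiCompact g := inferInstanceAs (QuasiCompact (f ≫ (projectiveSpace n k).hom))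
  exact hS p hp k X g inferInstance inferInstance inferInstance hred

/-- **`p.Prime` is decoration modulo Hironaka.** `CoverResolution` together with the named fact
`Hironaka1964` (characteristic zero) gives the crux with the primality hypothesis deleted: for a
field with `CharP k p`, `p` is prime (the crux) or `0` (Hironaka, applied to the separated
finite-type reduced `k`-scheme `X`). [folklore] -/
theorem coverResolution_without_prime_of_hironaka (hH : Hironaka1964.{0}) (hC : CoverResolution) :
    ∀ p : ℕ, ∀ (k : Type) [Field k] [CharP k p] [PerfectField k] (n : ℕ)
      (X : AlgebraicGeometry.Scheme.{0})
      (f : X ⟶ (Literature.AlgebraicGeometry.Motives.projectiveSpace n k).left),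
      AlgebraicGeometry.IsIntegral X → AlgebraicGeometry.IsFinite f → Function.Surjective f.base →
      (letI := MvPolynomial.gradedAlgebra (σ := Fin (n + 1)) (R := k);
        AlgebraicGeometry.Etale (f ∣_ (AlgebraicGeometry.Proj.basicOpen
          (MvPolynomial.homogeneousSubmodule (Fin (n + 1)) k) (MvPolynomial.X (Fin.last n))))) →
      Literature.AlgebraicGeometry.Resolution.Scheme.HasResolution X := by
  intro p k _ _ _ n X f hint hfin hsurj het
  rcases CharP.char_is_prime_or_zero k p with hp | hp
  · exact hC p hp k n X f hint hfin hsurj het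
  · subst hp
    haveI := hfin
    haveI : IsProper (projectiveSpace n k).hom := isProper_projectiveSpace n k
    let g : X ⟶ Spec (.of k) := f ≫ (projectiveSpace n k).hom
    haveI : IsSeparated g := inferInstanceAs (IsSeparated (f ≫ (projectiveSpace n k).hom))
    haveI : LocallyOfFiniteType g :=
      inferInstanceAs (LocallyOfFiniteType (f ≫ (projectiveSpace n k).hom))
    haveI : QuasiCompact g := inferInstanceAs (QuasiCompact (f ≫ (projectiveSpace n k).hom))
    exact hH k X g inferInstance inferInstance inferInstance inferInstance

end Summit.ResolutionOfSingularities.ResolutionOfSingularities.Theorems.CoverResolution.Negative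

end
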